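import Mathlib
import Summits.ValiantsHypothesis.ValiantsHypothesis.Statement
import Summits.ValiantsHypothesis.ValiantsHypothesis.Cruxes.OrbitDimensionBound.Lines.ConfusionLadder

/-!
# `onpath` — F4 on-path lemmas for the rung `ConfusionCovering` (sorry-free)

The rung is a member of the graded family `CoveringRung ℓ` (`Lines/ConfusionLadder.lean`).  Landed here BY NAME:

* `rung_mono` — DIAL MONOTONICITY (harder-to-easier): a pointwise larger loss `ℓ ≤ ℓ'` gives
  `CoveringRung ℓ → CoveringRung ℓ'`; the floor is the member `ℓ = 2^r` (`Special.rung_at_floor`), the rung the member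
  `ℓ = κ_{⌊n/2⌋}(Λ)` (confusion number), and `κ ≤ 2^r` (Odlyzko 1988, tree named fact
  `odlyzko_ncard_hypercube_inter_translate_le`) orders them: rung ⇒ floor modulo that named fact.
* `shadow_of_summit` — `S → shadow`: the summit `ValiantsHypothesis` (`VP_ℂ ≠ VNP_ℂ`) is asymptotic and symmetry-free,
  so `S → ConfusionCovering` (a fixed-`n` inequality) carries no content until the rung is itself proved; what `S`
  DOES imply is the rung's asymptotic shadow `CoveringShadow confusionLoss` (along every sequence of admissibly cut
  subtori and equivariant representations of `per_n` of sizes `m_n`, `n ↦ m_n · κ(Λ_n)` is not p-bounded):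
  `dc(per_n) ≤ m_n`, p-bounded `dc(per)` ⇒ `per ∈ VP` (Berkowitz, tree) ⇒ `VP = VNP` (VNP-completeness, tree).
* `relaxed_closing` — ROUTE-RELATIVE on-path statement: with the rung, the host route's open crux
  `OrbitDimensionBound` relaxes to `OrbitConfusionBound` (symmetrise to ANY admissible `Λ` of middle-level confusion
  `≤ 2^{⌊n/2⌋}`), and `OrbitConfusionBound → ConfusionCovering → ValiantsHypothesis` is proved (`closes_relaxed`).
-/

set_option linter.dupNamespace false

namespace Summit.ValiantsHypothesis.ValiantsHypothesis.Cruxes.OrbitDimensionBound.Confusion.OnPath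

open Summit.ValiantsHypothesis.ValiantsHypothesis.Cruxes.OrbitDimensionBound.Confusion

/-- Dial monotonicity of the rung family (harder-to-easier in the loss). [folklore] -/
theorem rung_mono {ℓ ℓ' : Loss} (hle : ∀ n r Λ, ℓ n r Λ ≤ ℓ' n r Λ) :
    CoveringRung ℓ → CoveringRung ℓ' :=
  CoveringRung.mono hle

/-- `S →` the asymptotic shadow of the rung. [cite: Burgisser2000, Thm. 2.10] -/
theorem shadow_of_summit : _root_.ValiantsHypothesis → CoveringShadow confusionLoss :=
  confusionShadow_of_summit

/-- `S →` the asymptotic shadow of EVERY member of the family with loss `≥ 1`. [cite: Burgisser2000, Thm. 2.10] -/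
theorem shadow_of_summit' {ℓ : Loss} (hℓ : ∀ n r Λ, 3 ≤ n → 1 ≤ ℓ n r Λ) :
    _root_.ValiantsHypothesis → CoveringShadow ℓ :=
  coveringShadow_of_summit hℓ

/-- Route-relative on-path: the relaxed symmetrisation target plus the rung decide the summit.
[cite: LandsbergRessayre2017, Question 2.2] -/
theorem relaxed_closing : OrbitConfusionBound → ConfusionCovering → _root_.ValiantsHypothesis :=
  closes_relaxed

end Summit.ValiantsHypothesis.ValiantsHypothesis.Cruxes.OrbitDimensionBound.Confusion.OnPath
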